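import Summits.QuantumFields.BalabanUV.T4Continuum.Support.NE7ApeCurvedRepRoadBSharp
import Summits.QuantumFields.BalabanUV.T4Continuum.Support.NE7GradientCurrencyCurvedSharp
import Summits.QuantumFields.BalabanUV.T4Continuum.Support.NE7RelPlaqCodifferentialBounds
import Summits.QuantumFields.BalabanUV.T4Continuum.Support.NE3AxialGaugeLadder
import HarnessLib

/-!
# NE7ApeCurvedRepRoadBGradientSharp — ROAD (B) WITH THE GRADIENT LETTER DISCHARGED AT BAŁABAN's ORDER: F123 re-assembled on the SHARP gradient currency F121b (F116b's axial-gauge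
# divergence bookkeeping through the plaquette-gradient radius `x₁`), so that `α₁^Z = 4(dα_E∕R + R(j_U + j_W + d·K + 2(b₀ + 3c_RE b₀))) + (4R(8d(e^{4α_E}−1)x + 10dx + 2δ + 12da²) + 4a)α_E
# + 2xα_E` (`a = 2d(R+1)x`, `δ = 2d²(R+1)x₁ + 8d³(R+1)²x²`) — at `R = M` every term is `α_E∕M`, `M·(radii)` or `α_E·(M²x₁·M, M³x², Mx)`-small: ONE POWER OF `M` below the sup, as the
# (APE) currency line requires when `K_G ≍ M`; file 54b

Cell `pub-balaban`, rung (B)+1 sub-cell t4, lineage `b2b-balaban-t4-ne7-p1` (CRUX PROVER NE7 #1 = OWNER of row NE7), generation 79; memo `t4/b2b-balaban-t4-ne7-p1-g79/GRADIENT-LETTER.md` §4.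
File F123b = F123's composition with F121b `NE7GradientCurrencyCurvedSharp.norm_gradMember_le_periodic_sharp` in place of F121 (everything else BY NAME as in F123: F108, F111, F113's split, F114,
E′, F122b, (1.11) `B8Ineq132.norm_covDiv_gaugeAct`, `NE3AxialGaugeLadder.smallField_gaugeAct`).  The extra input is NONE: the plaquette-gradient radius `x₁` of `W` (`hgrad`) is already a
hypothesis of F115 (row NE3's class datum); the smallness line becomes `16dR·2d(R+1)x + 32dR(e^{4α_E} − 1) ≤ 1` (at `R = M`: `M²x` and `Mα_E` small — E′'s and the class's regime).
WHY (memo §4).  With the flat slice solver `K_G ≍ M`, F78's products `K_G·α₀·α₁` close the bootstrap only if `α₁ = O(α₀∕M)`; F123's curvature term `4d²R²xα_E` is `O(M²x)α_E` — level-uniform,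
no power of `M`; F121b's is `O(M³x², M³x₁, Mx)·α_E` — the power of `M` with level-free smalls `(M²x)²∕M`, `(M³x₁)∕… `.  Precisely, at `R = M`: `dα_E∕M` + `M(j_U + j_W + dK + 2(1+3c_RE)b₀)` +
`α_E·[32dM(e^{4α_E}−1)x + 40dMx + 16d²M(M+1)x₁ + 64d³M(M+1)²x² + 192d³M(M+1)²x² + 8d(M+1)x + 2x]`.
WHAT ([folklore]; 0 def, 0 sorry).  **`smallField_of_tanCritical_roadB_gradientSharp`**.
HONEST FRAMING (page 1): composition; (L2) and the flux-divergence radii `j_U, j_W` ((1.9) TYPE) are HYPOTHESES; nothing of Bałaban's asserted; (APE) on curved data NOT proved unconditionally;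
NOT ONE-STEP, NOT NE7; spine 0∕9; finite T⁴ rung (B)+1 — NOT infinite volume, NOT mass gap, NOT `BetaPertH`, NOT Clay.  Continuum YM on T⁴ ⇐ BetaPertH ∧ nine spine estimates (0/9 proved);
BetaPertH ⇐ (D1) ∧ (D4) ∧ CAP+tail; G-an2-4 gates asym, D1 and NE2/3/4.
-/
set_option autoImplicit false

open scoped BigOperators Matrix Matrix.Norms.L2Operator
open NormedSpace Finset

namespace Summit.QuantumFields.BalabanUV.T4Continuum.NE7ApeCurvedRepRoadBGradientSharp

open Literature.MathematicalPhysics.QuantumFieldTheory.Balaban1983to89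
open B7Prop1Explicit B7Prop2Explicit MatrixLog UnitaryModel
open T4AveragingDeficitWall (Ad IsUnitaryCfg IsSkewDir SmallField vary curlAt dirL1)
open T4AveragingDeficitWallBoundary (IsPeriodicCfg periodBox)
open AveragingDeficitPeriodicCounting (IsPeriodicDir)
open AveragingDeficitTwoLevelPrep (twoLevelSmall)
open AveragingDeficitMultiLevelPrep (cavgIter LevelSmall)
open MinimalActionLevels (perWin)
open BlockAverageVaryHolo (nbRad)
open BlockAveragePushDirGauge (gaugeDir)
open NE3HessForm (hess dAction)
open NE3TangentCovariantTower (dirIter)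
open NE3EnergyShapes (IsUnitarySite IsPeriodicSite)
open NE3CovariantWeitzenbock (covDiv)
open NE3RightInverseSupLetters (frameC supC corrC)
open NE3QbarIterCovLiftPrep (cruxC)
open NE3RightInverseSolveLetters (thetaLoc cruxC_nonneg)
open NE3HatInvCurlLetters (curl1C)
open BlockAverageVaryDisc (rho0)
open NE3LinearisedAverageSup (curvSum)
open NE3ResidualSliceRep (dirIter_sub)
open NE3.CurvedLandauRep (exists_landauRep_W)
open AveragingDeficitTransport (norm_Ad_of_unitary mem_U1_of_unitary)
open NE3AxialGaugeLadder (smallField_gaugeAct)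
open NE3CovariantCalculus (cD cDstar)
open NE7ApeCurvedRepPointedGauge (smallField_of_tanCritical_pointedGauge)
open NE7SameTopNormalLift (exists_normalLift_sameTop)
open NE7ApeCurvedRepRoadBFinal (norm_grad_structured_le)
open NE7CovariantTentExtension (exists_tent_extension)
open NE7CurvedRemainderCodifferential (norm_cD_le)
open NE7GradientCurrencyCurvedSharp (norm_gradMember_le_periodic_sharp)
open NE7RelPlaqCodifferentialBounds (norm_codiff_relPlaq_le_of_covDiv_bounds)

noncomputable section

variable {d : ℕ} {n : Type*} [Fintype n] [DecidableEq n]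

/-- **ROAD (B) WITH THE GRADIENT LETTER DISCHARGED AT BAŁABAN's ORDER** (statement in the module docstring). [folklore] -/
theorem smallField_of_tanCritical_roadB_gradientSharp [Nonempty n] (hd : 2 ≤ d) {L N : ℕ} [NeZero N] (hL : 2 ≤ L) (j : ℕ)
    -- the background
    {W : Site d → Fin d → (Matrix n n ℂ)ˣ} {x : ℝ} (hWu : IsUnitaryCfg W) (hWP : IsPeriodicCfg W ((N * L ^ (j + 1) : ℕ) : ℤ))
    (hx : 0 ≤ x) (hs : LevelSmall d L j x) (hWx : SmallField W x)
    -- the sup radius of the representative and the regime at `x′ = x + 4(e^{α₀} − 1)`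
    {α₀ : ℝ} (hα0 : 0 ≤ α₀) (hs' : LevelSmall d L j (x + 4 * (Real.exp α₀ - 1)))
    (hθ : cruxC d L * (((L : ℝ) ^ (j + 1)) ^ 2 * (x + 4 * (Real.exp α₀ - 1))) < 1)
    (hθl : thetaLoc d L * (((L : ℝ) ^ (j + 1)) ^ 2 * (x + 4 * (Real.exp α₀ - 1))) < 1)
    (hε : ((L : ℝ) ^ (j + 1)) ^ 2 * (x + 4 * (Real.exp α₀ - 1)) ≤ 1)
    -- the field: of the class, tangent-critical, over `W`'s datum
    {U : Site d → Fin d → (Matrix n n ℂ)ˣ} (hUu : IsUnitaryCfg U) (hUP : IsPeriodicCfg U ((N * L ^ (j + 1) : ℕ) : ℤ))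
    {xU : ℝ} (hxU : 0 ≤ xU) (hsU : LevelSmall d L j xU) (hUxU : SmallField U xU)
    (hcritU : ∀ Y : Site d → Fin d → Matrix n n ℂ, IsSkewDir Y → IsPeriodicDir Y ((N * L ^ (j + 1) : ℕ) : ℤ) →
      dirIter L (j + 1) U Y = 0 → dAction U Y (perWin d (N * L ^ (j + 1))) = 0)
    (hTopUW : cavgIter L (j + 1) U = cavgIter L (j + 1) W)
    -- row NE3's class data of `W` and E′'s initial gauge ∕ regime (as in `exists_landauRep_W`), the constant `c_RE` named; road (B)'s two extra regime lines
    {x₁ : ℝ} (hx10 : 0 ≤ x₁)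
    (hgrad : ∀ (p : Site d) (μ κ : Fin d), κ ≠ μ →
      ‖Ad (W p μ) ((hol W (p + e μ) (plaqWord κ μ) : (Matrix n n ℂ)ˣ) : Matrix n n ℂ) - ((hol W p (plaqWord κ μ) : (Matrix n n ℂ)ˣ) : Matrix n n ℂ)‖ ≤ x₁)
    (hbx : 23040 * (d : ℝ) ^ 4 * (frameC d L + d) ^ 2 * ((L : ℝ) ^ (j + 1)) ^ 2 * x ≤ 1)
    (hcx : 11520 * (d : ℝ) ^ 4 * (frameC d L + d) ^ 3 * ((L : ℝ) ^ (j + 1)) ^ 3 * x₁ ≤ 1)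
    (hbx' : 256 * (d : ℝ) ^ 2 * ((L : ℝ) ^ (j + 1)) ^ 2 * x ≤ 1) (hcx' : 16 * (d : ℝ) * ((L : ℝ) ^ (j + 1)) ^ 3 * x₁ ≤ 1)
    {r₀ b₀ : ℝ} (hr₀ : ∀ (y : Site d) (μ : Fin d), ‖(((W y μ)⁻¹ * U y μ : (Matrix n n ℂ)ˣ) : (Matrix n n ℂ)) - 1‖ ≤ r₀)
    (hb₀ : ∀ x : Site d, ‖covDiv W (fun y μ => mlog (((W y μ)⁻¹ * U y μ : (Matrix n n ℂ)ˣ) : (Matrix n n ℂ))) x‖ ≤ b₀)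
    {cRE : ℝ} (hcRE : cRE = 1 + 2 * (Fintype.card n : ℝ) * (64 * (d : ℝ) ^ 2 * N) ^ d + 27 * (Fintype.card n : ℝ) ^ 3 * (512 : ℝ) ^ d * (N : ℝ) ^ d)
    (hreg₁ : (36 * (d : ℝ) * (frameC d L + d) ^ 2) * ((L : ℝ) ^ (j + 1)) ^ 2 * (cRE * b₀) ≤ 1 / 10)
    (hreg₂ : (36 * (d : ℝ) * (frameC d L + d)) * (L : ℝ) ^ (j + 1) * (cRE * b₀) ≤ 1 / 25)
    (hreg₃ : r₀ + 5 / 2 * ((36 * (d : ℝ) * (frameC d L + d)) * (L : ℝ) ^ (j + 1) * (cRE * b₀)) ≤ 1 / 20)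
    (hline : cRE * (4 * ((36 * (d : ℝ) * (frameC d L + d) ^ 2) * ((L : ℝ) ^ (j + 1)) ^ 2) * (b₀ + 4 * (cRE * b₀))
        + 25 * d * (r₀ + 5 / 2 * ((36 * (d : ℝ) * (frameC d L + d)) * (L : ℝ) ^ (j + 1) * (cRE * b₀))) * ((36 * (d : ℝ) * (frameC d L + d)) * (L : ℝ) ^ (j + 1))
        + 14 * d * ((36 * (d : ℝ) * (frameC d L + d)) * (L : ℝ) ^ (j + 1)) ^ 2 * (cRE * b₀)) ≤ 1 / 2)
    -- E′'s radii named: `α_E`, `θ_u`; the tent extension's `δ = corrC∕M·2θ_u`; road (B)'s regime `α_E ≤ 1∕40`, `θ_u ≤ 1∕160`, `δ ≤ 1∕40`, `α₀ ≥ α_E + δ + 4(2θ_u+δ)(α_E+δ)`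
    {αE θu : ℝ} (hαE : αE = 2 * (r₀ + 5 / 2 * ((36 * (d : ℝ) * (frameC d L + d)) * (L : ℝ) ^ (j + 1) * (cRE * b₀))))
    (hθu : θu = 4 * ((36 * (d : ℝ) * (frameC d L + d) ^ 2) * ((L : ℝ) ^ (j + 1)) ^ 2 * (cRE * b₀)))
    (hαE40 : αE ≤ 1 / 40) (hθu160 : θu ≤ 1 / 160)
    {δ : ℝ} (hδ : δ = corrC d / (L : ℝ) ^ (j + 1) * (2 * θu)) (hδ40 : δ ≤ 1 / 40) (hα₀ : αE + δ + 4 * (2 * θu + δ) * (αE + δ) ≤ α₀)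
    -- the remaining analytic letters at `W`: (L1)′ and α₁ for the SAME-TOP structured fields of radius `α₀`, (L2), (L3) discharged
    -- (L1)′ DISCHARGED (F111): the quadratic-remainder regime, the slice `S` containing the `W`-tangent skew periodic fields, and the names `c_N = 4m`, `ν = 24·#Plane·m`
    (hs1 : LevelSmall d L (j + 1) x) (hA : curvSum d L (j + 1) x ≤ 2 / 3 * L) (hσ0 : 4 * (3 + 12 * (d : ℝ)) ^ 2 * (L : ℝ) ^ (j + 1) * α₀ ≤ rho0 d L ^ 2)
    (S : Set (Site d → Fin d → Matrix n n ℂ))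
    (hS : ∀ X : Site d → Fin d → Matrix n n ℂ, IsSkewDir X → IsPeriodicDir X ((N * L ^ (j + 1) : ℕ) : ℤ) → dirIter L (j + 1) W X = 0 → X ∈ S)
    {cN KG ν : ℝ} (hcN : cN = 4 * (supC d L / ((L : ℝ) ^ (j + 1) * (1 - cruxC d L * (((L : ℝ) ^ (j + 1)) ^ 2 * x)))
        * (4 * (3 + 12 * (d : ℝ)) ^ 3 / rho0 d L ^ 2 * ((L : ℝ) ^ (j + 1) * α₀) ^ 2)))
    (hνm : ν = 24 * (Fintype.card (T4AveragingDeficitWall.Plane d) : ℝ) * (supC d L / ((L : ℝ) ^ (j + 1) * (1 - cruxC d L * (((L : ℝ) ^ (j + 1)) ^ 2 * x)))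
        * (4 * (3 + 12 * (d : ℝ)) ^ 3 / rho0 d L ^ 2 * ((L : ℝ) ^ (j + 1) * α₀) ^ 2)))
    -- THE GRADIENT LETTER DISCHARGED (sharp): a radius `R ≥ 1` with `16dR·2d(R+1)x + 32dR(e^{4α_E} − 1) ≤ 1` and the (1.9)-TYPE flux-divergence radii of `U`, `W`
    {R : ℕ} (hR : 1 ≤ R) (hsmall : 16 * (d : ℝ) * R * (2 * (d : ℝ) * (R + 1) * x) + 32 * (d : ℝ) * R * (Real.exp (4 * αE) - 1) ≤ 1)
    {jU jW : ℝ} (hjU : ∀ (ν : Fin d) (y : Site d), ‖B8Ineq132.covDiv 1 U ν y‖ ≤ jU) (hjW : ∀ (ν : Fin d) (y : Site d), ‖B8Ineq132.covDiv 1 W ν y‖ ≤ jW)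
    (hG : ∀ X ∈ S, IsPeriodicDir X ((N * L ^ (j + 1) : ℕ) : ℤ) → dirIter L (j + 1) W X = 0 → ∀ g : ℝ, 0 ≤ g →
      (∀ Y : Site d → Fin d → Matrix n n ℂ, IsSkewDir Y → IsPeriodicDir Y ((N * L ^ (j + 1) : ℕ) : ℤ) → dirIter L (j + 1) W Y = 0 →
        |hess W X Y (perWin d (N * L ^ (j + 1)))| ≤ g * dirL1 Y (periodBox (d := d) (N * L ^ (j + 1)))) →
      ∀ z μ' ν', μ' ≠ ν' → ‖curlAt W X z μ' ν'‖ ≤ KG * g)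
    (hcritW : ∀ Y : Site d → Fin d → Matrix n n ℂ, IsSkewDir Y → IsPeriodicDir Y ((N * L ^ (j + 1) : ℕ) : ℤ) → dirIter L (j + 1) W Y = 0 →
      dAction W Y (perWin d (N * L ^ (j + 1))) = 0) :
    SmallField U (x + (KG * (
        ((x + 4 * (Real.exp α₀ - 1))
            * ((curl1C d L / (1 - thetaLoc d L * (((L : ℝ) ^ (j + 1)) ^ 2 * (x + 4 * (Real.exp α₀ - 1)))))
                * (((L : ℝ) ^ (j + 1)) ^ d / ((L : ℝ) ^ (j + 1)) ^ 2))
            * (Real.exp (((L : ℝ) ^ d / L) * ((d : ℝ) * (16 * ((d : ℝ) + 1) * ((d : ℝ) + 4) * (L : ℝ) ^ 2)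
                  * (1250 * ((nbRad d L : ℝ) + L) + 8 * ((d : ℝ) * L) + 2 * L)) * (2 / twoLevelSmall d L))
                * ((L : ℝ) / (L : ℝ) ^ d) ^ j
                * (((d : ℝ) * (2 * nbRad d L + 1) ^ d) * ((2 * (d : ℝ) + 4) * (L : ℝ) ^ 2) * (2 * (L : ℝ) ^ j) * (Real.exp α₀ - 1)
                  + (17 / 8 * ((L : ℝ) ^ 2) ^ j * (x + 4 * (Real.exp α₀ - 1)))
                    * (((d : ℝ) * (2 * nbRad d L + 1) ^ d) * ((2 * (d : ℝ) + 4)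
                          * (2 * (2 * L * (nbRad d L : ℝ) + 128 * ((d : ℝ) + 1) * ((d : ℝ) + 4) * (L : ℝ) ^ 2)))
                      + ((d : ℝ) * (2 * nbRad d L + 1) ^ d) * ((2 * (d : ℝ) + 4) * (L : ℝ) ^ 2 * (2 * (nbRad d L : ℝ))
                          + 2 * (8 * (L : ℝ) + (1250 * ((nbRad d L : ℝ) + L) + 8 * (d * L) + 2 * L))
                              * (16 * ((d : ℝ) + 1) * ((d : ℝ) + 4) * (L : ℝ) ^ 2))))))
        + (Fintype.card (T4AveragingDeficitWall.Plane d) : ℝ)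
          * (2 * (240 * (Real.exp α₀ - 1) * α₀ * (2 * ((4 * ((d : ℝ) * αE / R + R * ((jU + jW + d * (2 * (Real.exp αE - 1) * xU + 2 * (xU * x) + 2 * (x * (2 + x) * x) + 2 * (xU * (2 + xU) * xU))) + 2 * (b₀ + 3 * (cRE * b₀)))) + (4 * R * (8 * d * (Real.exp (4 * αE) - 1) * x + 10 * d * x + 2 * (2 * (d : ℝ) ^ 2 * (R + 1) * x₁ + 8 * (d : ℝ) ^ 3 * ((R : ℝ) + 1) ^ 2 * x ^ 2) + 12 * d * (2 * (d : ℝ) * (R + 1) * x) ^ 2) + 4 * (2 * (d : ℝ) * (R + 1) * x)) * αE + 2 * x * αE) + 2 * δ + 2 * (4 * (2 * θu + δ) * (αE + δ))) + 24 * α₀ * (Real.exp α₀ - 1) + x) + 8 * α₀ * (2 * ((4 * ((d : ℝ) * αE / R + R * ((jU + jW + d * (2 * (Real.exp αE - 1) * xU + 2 * (xU * x) + 2 * (x * (2 + x) * x) + 2 * (xU * (2 + xU) * xU))) + 2 * (b₀ + 3 * (cRE * b₀)))) + (4 * R * (8 * d * (Real.exp (4 * αE) - 1) * x + 10 * d *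 x + 2 * (2 * (d : ℝ) ^ 2 * (R + 1) * x₁ + 8 * (d : ℝ) ^ 3 * ((R : ℝ) + 1) ^ 2 * x ^ 2) + 12 * d * (2 * (d : ℝ) * (R + 1) * x) ^ 2) + 4 * (2 * (d : ℝ) * (R + 1) * x)) * αE + 2 * x * αE) + 2 * δ + 2 * (4 * (2 * θu + δ) * (αE + δ))) + 24 * α₀ * (Real.exp α₀ - 1))
              + 6 * (Real.exp α₀ - 1) * (2 * ((4 * ((d : ℝ) * αE / R + R * ((jU + jW + d * (2 * (Real.exp αE - 1) * xU + 2 * (xU * x) + 2 * (x * (2 + x) * x) + 2 * (xU * (2 + xU) * xU))) + 2 * (b₀ + 3 * (cRE * b₀)))) + (4 * R * (8 * d * (Real.exp (4 * αE) - 1) * x + 10 * d * x + 2 * (2 * (d : ℝ) ^ 2 * (R + 1) * x₁ + 8 * (d : ℝ) ^ 3 * ((R : ℝ) + 1) ^ 2 * x ^ 2) + 12 * d * (2 * (d : ℝ) * (R + 1) * x) ^ 2) + 4 * (2 * (d : ℝ) * (R + 1) * x)) * αE + 2 * x * αE) + 2 * δ + 2 * (4 * (2 * θu + δ) * (αE +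 δ))) + 24 * (Real.exp α₀ - 1) * α₀)
              + (2 * ((4 * ((d : ℝ) * αE / R + R * ((jU + jW + d * (2 * (Real.exp αE - 1) * xU + 2 * (xU * x) + 2 * (x * (2 + x) * x) + 2 * (xU * (2 + xU) * xU))) + 2 * (b₀ + 3 * (cRE * b₀)))) + (4 * R * (8 * d * (Real.exp (4 * αE) - 1) * x + 10 * d * x + 2 * (2 * (d : ℝ) ^ 2 * (R + 1) * x₁ + 8 * (d : ℝ) ^ 3 * ((R : ℝ) + 1) ^ 2 * x ^ 2) + 12 * d * (2 * (d : ℝ) * (R + 1) * x) ^ 2) + 4 * (2 * (d : ℝ) * (R + 1) * x)) * αE + 2 * x * αE) + 2 * δ + 2 * (4 * (2 * θu + δ) * (αE + δ))) + 24 * (Real.exp α₀ - 1) * α₀) * (2 * ((4 * ((d : ℝ) * αE / R + R * ((jU + jW + d * (2 * (Real.exp αE - 1) * xU + 2 * (xU * x) + 2 * (x * (2 + x) * x) + 2 * (xU * (2 + xU) * xU))) + 2 * (b₀ + 3 * (cRE * b₀)))) + (4 * R * (8 * d * (Real.exp (4 * αE) - 1) * x + 10 * d * x + 2 * (2 * (d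 : ℝ) ^ 2 * (R + 1) * x₁ + 8 * (d : ℝ) ^ 3 * ((R : ℝ) + 1) ^ 2 * x ^ 2) + 12 * d * (2 * (d : ℝ) * (R + 1) * x) ^ 2) + 4 * (2 * (d : ℝ) * (R + 1) * x)) * αE + 2 * x * αE) + 2 * δ + 2 * (4 * (2 * θu + δ) * (αE + δ))) + 24 * α₀ * (Real.exp α₀ - 1))
              + 960 * (Real.exp α₀ - 1) * α₀ ^ 2 + 32 * x * α₀ ^ 2)
            + (64 * α₀ * ((4 * ((d : ℝ) * αE / R + R * ((jU + jW + d * (2 * (Real.exp αE - 1) * xU + 2 * (xU * x) + 2 * (x * (2 + x) * x) + 2 * (xU * (2 + xU) * xU))) + 2 * (b₀ + 3 * (cRE * b₀)))) + (4 * R * (8 * d * (Real.exp (4 * αE) - 1) * x + 10 * d * x + 2 * (2 * (d : ℝ) ^ 2 * (R + 1) * x₁ + 8 * (d : ℝ) ^ 3 * ((R : ℝ) + 1) ^ 2 * x ^ 2) + 12 * d * (2 * (d : ℝ) * (R + 1) * x) ^ 2) + 4 * (2 * (d : ℝ) * (R + 1) * x)) * αE + 2 * x * αE) + 2 * δ +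 2 * (4 * (2 * θu + δ) * (αE + δ))) + 1024 * x * α₀ ^ 2))
        + ν) + cN + 28 * α₀ ^ 2)) := by
  have hd1 : 1 ≤ d := by omega
  have hL1 : 1 ≤ L := by omega
  have hPper : 1 ≤ N * L ^ (j + 1) := Nat.mul_pos (Nat.pos_of_ne_zero (NeZero.ne N)) (Nat.pow_pos (by omega))
  -- the right-inverse regime at `x` from the one at `x′ ≥ x`
  have hexp : 0 ≤ 4 * (Real.exp α₀ - 1) := by have := Real.add_one_le_exp α₀; linarith
  have hM2 : 0 ≤ ((L : ℝ) ^ (j + 1)) ^ 2 := by positivity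
  have hxx' : ((L : ℝ) ^ (j + 1)) ^ 2 * x ≤ ((L : ℝ) ^ (j + 1)) ^ 2 * (x + 4 * (Real.exp α₀ - 1)) :=
    mul_le_mul_of_nonneg_left (by linarith) hM2
  have hθx : cruxC d L * (((L : ℝ) ^ (j + 1)) ^ 2 * x) < 1 :=
    (mul_le_mul_of_nonneg_left hxx' (cruxC_nonneg d L)).trans_lt hθ
  have hεx : ((L : ℝ) ^ (j + 1)) ^ 2 * x ≤ 1 := hxx'.trans hε
  have h1θ : 0 < 1 - cruxC d L * (((L : ℝ) ^ (j + 1)) ^ 2 * x) := by linarith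
  have hsupC0 : 0 ≤ supC d L := by
    unfold supC NE3RightInverseSupLetters.corrC NE3RightInverseSupLetters.frameC; have := NE3QbarIterCovLiftPrep.liftC_nonneg d; positivity
  have hν : 0 ≤ ν := by rw [hνm]; positivity
  -- signs of the named radii (kept as atoms: no `subst` of the long constants)
  have hb0 : 0 ≤ b₀ := (norm_nonneg _).trans (hb₀ 0)
  have hr0 : 0 ≤ r₀ := (norm_nonneg _).trans (hr₀ 0 ⟨0, by omega⟩)
  have hfr : 0 ≤ frameC d L := by unfold frameC; positivity
  have hc0 : 0 ≤ corrC d := zero_le_one.trans (NE3RightInverseSupLetters.one_le_corrC d)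
  have hcRE0 : 0 ≤ cRE := by rw [hcRE]; positivity
  have hθu0 : 0 ≤ θu := by rw [hθu]; positivity
  have hαE0 : 0 ≤ αE := by rw [hαE]; positivity
  have hδ0 : 0 ≤ δ := by rw [hδ]; positivity
  have hjU0 : 0 ≤ jU := (norm_nonneg _).trans (hjU ⟨0, by omega⟩ 0)
  have hjW0 : 0 ≤ jW := (norm_nonneg _).trans (hjW ⟨0, by omega⟩ 0)
  have ht40 : 2 * θu ≤ 1 / 40 := by linarith only [hθu160]
  have hθu4 : θu ≤ 1 / 4 := by linarith only [hθu160]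
  -- E′ (regime lines with the constant spelled out; outputs folded back into the atoms `cRE`, `αE`, `θu`)
  rw [hcRE] at hreg₁ hreg₂ hreg₃ hline
  obtain ⟨u, Z, huU, huP, hZs, hZP, hrep, hLan, -, hZsup, hu1, hcov⟩ :=
    exists_landauRep_W hd1 hL j hWu hWP hx hs hWx hx10 hgrad hbx hcx hbx' hcx' hUu hUP hr₀ hb₀ hreg₁ hreg₂ hreg₃ hline
  rw [← hcRE] at hZsup hu1 hcov
  rw [← hαE] at hZsup
  rw [← hθu] at hu1
  -- THE GRADIENT MEMBER OF `Z` from F121 + F122b: the relative-plaquette datum against the radii `j_U` (gauge invariance of (1.2)) and `j_W`, the divergence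
  -- gradient from E′'s reaction
  have hu1' : ∀ y, u y ∈ U1 (Matrix n n ℂ) := fun y => mem_U1_of_unitary (huU y)
  have hjU' : ∀ (ν' : Fin d) (y : Site d), ‖B8Ineq132.covDiv 1 (gaugeAct u U) ν' y‖ ≤ jU := fun ν' y => by
    rw [B8Ineq132.norm_covDiv_gaugeAct 1 hu1' U ν' y]; exact hjU ν' y
  have hP : ∀ (y : Site d) (ν' : Fin d), ‖cD W ν' (covDiv W Z) y‖ ≤ 2 * (b₀ + 3 * (cRE * b₀)) := fun y ν' =>
    (norm_cD_le hWu ν' (covDiv W Z) y).trans ((add_le_add (hcov _) (hcov _)).trans (le_of_eq (two_mul _).symm))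
  have hGradZ := norm_gradMember_le_periodic_sharp hd1 hPper hWu hx hx10 hWx hgrad hWP Z hZP hZsup
    (fun y ν' => norm_codiff_relPlaq_le_of_covDiv_bounds hWu hx hWx hZs hZsup hrep hxU (smallField_gaugeAct huU hUxU) hjU' hjW y ν') hP hR hsmall
  -- `0 ≤ α₁` read off the gradient bound itself (no arithmetic on the long expression)
  have hα1 := add_nonneg (add_nonneg ((norm_nonneg _).trans (hGradZ 0 ⟨0, by omega⟩ ⟨0, by omega⟩)) (mul_nonneg zero_le_two hδ0))
    (mul_nonneg zero_le_two (mul_nonneg (mul_nonneg (by norm_num : (0 : ℝ) ≤ 4) (add_nonneg (mul_nonneg zero_le_two hθu0) hδ0)) (add_nonneg hαE0 hδ0)))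
  -- F114: the covariant tent extension of `u`'s corner values; the name `δ`
  obtain ⟨σ, hσs, hσP, hext, hσt, hσδ⟩ :=
    exists_tent_extension hL N j hWu hWP hx hs hWx hεx huU huP hu1 hθu4
  subst hδ
  -- F108 with (L1)′ by F111 and α₁ by the three-term split
  refine smallField_of_tanCritical_pointedGauge hd hL j hWu hWP hx hs hWx hα0 hs' hθ hθl hε hUu hUP hxU hsU hUxU hcritU hTopUW huU huP hrep hZsup hαE40
    hσs hσP hext hσt hσδ ht40 hδ40 hα₀ S hν ?_ hα1 ?_ hG hcritW
  · intro Z' hZ's hZ'P hZ'α hTop _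
    obtain ⟨AN, hANs, hANP, hANex, -, hANcurl, hANhess⟩ :=
      exists_normalLift_sameTop hL j hWu hWP hx hs hs1 hWx hθx hεx hA hZ's hZ'P hα0 hZ'α hσ0 hTop
    refine ⟨AN, hANP, hANex, fun z μ' ν' hne => ?_, fun Y _ hYP _ => ?_, hS _ (fun y μ => (skewAdjoint _).sub_mem (hZ's y μ) (hANs y μ)) ?_ ?_⟩
    · rw [hcN]; exact hANcurl z μ' ν' hne
    · rw [hνm]; exact hANhess Y hYP
    · intro y κ μ
      show Z' (y + _) μ - AN (y + _) μ = Z' y μ - AN y μ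
      rw [hZ'P y κ μ, hANP y κ μ]
    · rw [dirIter_sub hL1 j hWu hx hs hWx Z' AN, hANex]
      funext z κ
      exact sub_self _
  · intro Z' _ _ _ _ hstr y κ τ
    have h := norm_grad_structured_le (hWu (y + e κ) τ) (Z (y + e τ) κ) (Z y κ) (gaugeDir W σ (y + e τ) κ) (gaugeDir W σ y κ) (Z' (y + e τ) κ) (Z' y κ)
    refine h.trans ((add_le_add (add_le_add (hGradZ y κ τ) (add_le_add (hσδ (y + e τ) κ) (hσδ y κ)))
      (add_le_add (hstr (y + e τ) κ) (hstr y κ))).trans (le_of_eq ?_))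
    ring

end

end Summit.QuantumFields.BalabanUV.T4Continuum.NE7ApeCurvedRepRoadBGradientSharp
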